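import Summits.QuantumFields.BalabanUV.Beta.FP.TowerQN2RowCopies
import Summits.QuantumFields.BalabanUV.Beta.FP.NestedStepLawTorusInstance

/-!
# `BalabanUV.Beta.FP.TowerNSlotLetters` — road «FP», binder row D1, ROUTE T (β1), v6 BRIDGES (B2)(B3) of `g46/SPEC-58.md`: **THE END WRAPPER's N-SLOT LETTERS
# `hfN ∕ hmN ∕ hcN` AND THE COARSE READ-OUT's LINEARITY `hXbf` ARE THEOREMS OF THE TWO PINS** `fN a = (wrapPt T (Lc^(n+2)•↑a.1), inr a.2)` (#4 `TowerQN1Row`'s slot map on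
# the sources `pbox M × Fin 4`, `T = towerTorus Lc (fine Lc M) (n+1)`) and `Xbf v = c • diagonal (lv v ∘ g)` (R-FP-79's coarse read-out; `g` any site map, the wrapper's is
# `itRoot … (n+2) ∘ fst`)

WHY.  v5 (`FP/StepRecursionFeedNestedNamedD`) displays the N-side slot map `fN n B` with three letters (`hfN` injective, `hmN` multiplier-valued, `hcN` range = the sites with
`Torus.proj (LNc n) s = 0`) and the coarse read-out `Xbf n B` with its linearity `hXbf`; the road's row theorems (#4, #5, (Fam), PART 2∕3) PIN both.  v6 (SPEC-58 §1) feeds v5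
with the pins, so the four letters must be theorems of the pins: this file (the N-side twin of `NestedStepLawTorusInstance.coarseSlot_injective ∕ coarseSlot_range` for the
G-side slots, proofs line for line at the blocking `Lc^(n+2)`, `T i = Lc^(n+2)·M i` by `TowerQN2RowCopies.towerTorus_fine_apply`).
WHAT ([folklore] bookkeeping; no `def`, no `def … : Prop`, nothing cited, 0 sorry): §1 `smul_coe_mem_pbox_tower`, `wrapPt_tower_smul_coe`, **`towerSlot_injective`** (`hfN`),
**`towerSlot_inr`** (`hmN`), **`towerSlot_range`** (`hcN` at `LNc n := Lc^(n+2)`); §2 **`Xbf_linear_of_pin`** (`hXbf` from the pin and `hlv`).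
WHAT THIS IS NOT: not v6; nothing of Bałaban's asserted, valued or discharged; 0 estimates; 0∕4 row-D1 binders (hW, hR, D1Tel, D1Rep); ROOT M‴ p325680 ∕ P5c ∕ D6 untouched;
NOT (C1), NOT (T-ID), NOT D1, NEVER «G-an2-4 closed», NOT BetaPertH, NOT continuum, NOT Clay.

HONEST DEPENDENCY (page 1, mandatory): continuum YM on T⁴ ⇐ BetaPertH ∧ nine spine estimates (0/9 proved); BetaPertH ⇐ (D1) ∧ (D4) ∧ CAP+tail;
G-an2-4 gates asym, D1 and NE2/3/4.  HONEST FRAMING (cell contract, verbatim): «discharging `BetaPertH` makes Bałaban's UV stability UNCONDITIONAL —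
a real constructive-QFT result; it is NOT the continuum limit and NOT the Clay problem.»  ABSOLUTE RULE (cell charter, verbatim): «No internally-minted
statement may enter as a cited fact. Every hypothesis is either kernel-proved in this package or a verbatim quotation of a PUBLISHED theorem with page
reference. The manuscript(s) under audit are NOT citable for their own disputed steps — they are the thing under adjudication; programme-internal
(2001/route/tribunal) claims are never citable.»  Road «FP» OWNER, b2b-balaban-beta-d1-p3 gen 46, 2026-08-28.  No existing file touched.
-/

noncomputable section

namespace Summit.QuantumFields.BalabanUV.Beta.FP.TowerNSlotLetters

open Literature.Probability.LatticeModels (Torus.proj)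
open Literature.MathematicalPhysics.QuantumFieldTheory
open Literature.MathematicalPhysics.QuantumFieldTheory.Balaban1983to89
open Literature.MathematicalPhysics.QuantumFieldTheory.Balaban1983to89.Beta
open Literature.MathematicalPhysics.QuantumFieldTheory.LatticeForm (quo)
open B5Prop11Plancherel (fine)
open B6Lemma24Torus (pbox mem_pbox wrap_eq_self)
open AffineAveraging (Site)
open OneStepResolventKernel (Fib proj_zsmul)
open Summit.QuantumFields.BalabanUV.Beta.FP.KernelPeriodisationFib (Idx)
open Summit.QuantumFields.BalabanUV.Beta.FP.TorusGaugeCovariancePairing (wrapPt wrapPt_coe)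
open Summit.QuantumFields.BalabanUV.Beta.FP.TorusCompositeObjects (towerTorus)
open Summit.QuantumFields.BalabanUV.Beta.FP.TowerQN2RowCopies (towerTorus_fine_apply)
open Summit.QuantumFields.BalabanUV.Beta.GAN24.CombesThomasFibre (eq_zsmul_quo_of_proj_eq_zero)

/-! ## §1 The N-side slot map on the tower torus -/

section Slots

variable {Lc : ℕ} [NeZero Lc] (M : Fin (3 + 1) → ℕ) [∀ μ, NeZero (M μ)] (n : ℕ)

omit [∀ μ, NeZero (M μ)] in
/-- [folklore] the blocked coarse site lies in the tower torus box: `Lc^(n+2)•↑p ∈ pbox T` (`T i = Lc^(n+2)·M i`). -/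
theorem smul_coe_mem_pbox_tower (p : ↥(pbox M)) :
    ((Lc ^ (n + 1 + 1) : ℕ) : ℤ) • (p : Site (3 + 1)) ∈ pbox (towerTorus Lc (fine Lc M) (n + 1)) := by
  rw [mem_pbox]
  intro i
  have hp := (mem_pbox.mp p.2) i
  have hL : (0 : ℤ) < ((Lc ^ (n + 1 + 1) : ℕ) : ℤ) := by exact_mod_cast Nat.pos_of_ne_zero (NeZero.ne (Lc ^ (n + 1 + 1)))
  rw [towerTorus_fine_apply M n i, Pi.smul_apply, smul_eq_mul]
  push_cast
  exact ⟨mul_nonneg hL.le hp.1, mul_lt_mul_of_pos_left hp.2 hL⟩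

/-- [folklore] the slot's site IS the blocked coarse site: `↑(wrapPt T (Lc^(n+2)•↑p)) = Lc^(n+2)•↑p` (no wrapping happens). -/
theorem wrapPt_tower_smul_coe (p : ↥(pbox M)) :
    (wrapPt (towerTorus Lc (fine Lc M) (n + 1)) (((Lc ^ (n + 1 + 1) : ℕ) : ℤ) • (p : Site (3 + 1))) : Site (3 + 1))
      = ((Lc ^ (n + 1 + 1) : ℕ) : ℤ) • (p : Site (3 + 1)) := by
  rw [wrapPt_coe]; exact wrap_eq_self (smul_coe_mem_pbox_tower M n p)

/-- [folklore] **`towerSlot_injective` — v5's letter `hfN`**: the slot map `a ↦ (wrapPt T (Lc^(n+2)•↑a.1), inr a.2)` on `pbox M × Fin 4` is injective. -/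
theorem towerSlot_injective :
    Function.Injective (fun a : ↥(pbox M) × Fin (3 + 1) =>
      ((wrapPt (towerTorus Lc (fine Lc M) (n + 1)) (((Lc ^ (n + 1 + 1) : ℕ) : ℤ) • (a.1 : Site (3 + 1))), Sum.inr a.2) : Idx (towerTorus Lc (fine Lc M) (n + 1)) (Fib 3))) := by
  rintro ⟨p, κ⟩ ⟨p', κ'⟩ h
  simp only [Prod.mk.injEq, Sum.inr.injEq] at h
  obtain ⟨hp, hκ⟩ := h
  refine Prod.ext (Subtype.ext (funext fun i => ?_)) hκ
  have hc := congrArg (fun s : ↥(pbox (towerTorus Lc (fine Lc M) (n + 1))) => (s : Site (3 + 1)) i) hp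
  simp only [wrapPt_tower_smul_coe, Pi.smul_apply, smul_eq_mul] at hc
  exact mul_left_cancel₀ (by exact_mod_cast NeZero.ne (Lc ^ (n + 1 + 1))) hc

/-- [folklore] **`towerSlot_inr` — v5's letter `hmN`**: every slot is a multiplier index. -/
theorem towerSlot_inr (a : ↥(pbox M) × Fin (3 + 1)) :
    ∃ m : Fin (3 + 1), ((fun a : ↥(pbox M) × Fin (3 + 1) =>
      ((wrapPt (towerTorus Lc (fine Lc M) (n + 1)) (((Lc ^ (n + 1 + 1) : ℕ) : ℤ) • (a.1 : Site (3 + 1))), Sum.inr a.2) : Idx (towerTorus Lc (fine Lc M) (n + 1)) (Fib 3))) a).2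
        = Sum.inr m :=
  ⟨a.2, rfl⟩

/-- [folklore] **`towerSlot_range` — v5's letter `hcN` at `LNc n := Lc^(n+2)`**: the slot map hits exactly the multiplier indices at the coarse sites `Torus.proj (Lc^(n+2)) s = 0`. -/
theorem towerSlot_range (s : ↥(pbox (towerTorus Lc (fine Lc M) (n + 1)))) (m : Fin (3 + 1)) :
    ((s, Sum.inr m) : Idx (towerTorus Lc (fine Lc M) (n + 1)) (Fib 3)) ∈ Set.range (fun a : ↥(pbox M) × Fin (3 + 1) =>
        ((wrapPt (towerTorus Lc (fine Lc M) (n + 1)) (((Lc ^ (n + 1 + 1) : ℕ) : ℤ) • (a.1 : Site (3 + 1))), Sum.inr a.2) : Idx (towerTorus Lc (fine Lc M) (n + 1)) (Fib 3)))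
      ↔ Torus.proj (Lc ^ (n + 1 + 1)) (s : Site (3 + 1)) = 0 := by
  constructor
  · rintro ⟨⟨p, κ⟩, h⟩
    have hs : wrapPt (towerTorus Lc (fine Lc M) (n + 1)) (((Lc ^ (n + 1 + 1) : ℕ) : ℤ) • (p : Site (3 + 1))) = s := congrArg Prod.fst h
    rw [← hs, wrapPt_tower_smul_coe]; exact proj_zsmul _
  · intro hs
    have hL : (0 : ℤ) < ((Lc ^ (n + 1 + 1) : ℕ) : ℤ) := by exact_mod_cast Nat.pos_of_ne_zero (NeZero.ne (Lc ^ (n + 1 + 1)))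
    have hq : (s : Site (3 + 1)) = ((Lc ^ (n + 1 + 1) : ℕ) : ℤ) • quo (Lc ^ (n + 1 + 1)) (s : Site (3 + 1)) := eq_zsmul_quo_of_proj_eq_zero hs
    have ht : quo (Lc ^ (n + 1 + 1)) (s : Site (3 + 1)) ∈ pbox M := by
      rw [mem_pbox]; intro i
      have hsi := (mem_pbox.mp s.2) i
      have e : (s : Site (3 + 1)) i = ((Lc ^ (n + 1 + 1) : ℕ) : ℤ) * quo (Lc ^ (n + 1 + 1)) (s : Site (3 + 1)) i := by
        conv_lhs => rw [hq]
        rfl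
      rw [e, towerTorus_fine_apply M n i] at hsi
      push_cast at hsi
      exact ⟨(mul_nonneg_iff_of_pos_left hL).mp hsi.1, lt_of_mul_lt_mul_left hsi.2 hL.le⟩
    refine ⟨(⟨quo (Lc ^ (n + 1 + 1)) (s : Site (3 + 1)), ht⟩, m), ?_⟩
    simp only [Prod.mk.injEq, and_true]
    exact Subtype.ext (by rw [wrapPt_coe, ← hq]; exact wrap_eq_self s.2)

end Slots

/-! ## §2 The coarse read-out's linearity from its pin -/

section ReadOut

/-- [folklore] **`Xbf_linear_of_pin` — v5's letter `hXbf`** from the pin `Xbf v = c • diagonal (lv v ∘ g)` and the read-out's linearity `hlv`. -/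
theorem Xbf_linear_of_pin {κ σ ι : Type*} [Fintype ι] [DecidableEq ι] (c : ℝ) (lv : (κ → ℝ) → σ → ℝ)
    (hlv : ∀ (r : ℝ) (x y : κ → ℝ), lv (r • x + y) = r • lv x + lv y) (g : ι → σ) (Xbf : (κ → ℝ) → Matrix ι ι ℝ)
    (hXbf : ∀ v, Xbf v = c • Matrix.diagonal (fun a : ι => lv v (g a))) (r : ℝ) (x y : κ → ℝ) :
    Xbf (r • x + y) = r • Xbf x + Xbf y := by
  rw [hXbf, hXbf, hXbf, hlv]
  ext i j
  simp only [Matrix.smul_apply, Matrix.add_apply, Matrix.diagonal_apply, Pi.add_apply, Pi.smul_apply, smul_eq_mul]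
  split_ifs <;> ring

end ReadOut

end Summit.QuantumFields.BalabanUV.Beta.FP.TowerNSlotLetters

end
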